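import Literature.AlgebraicGeometry.Morphisms.NilpotentThickeningCoverLift
import Literature.AlgebraicGeometry.Motives.ChernClassesProofs
import HarnessLib

/-!
# Principal affine covers of a nilpotent thickening subordinate to a trivialising cover of a module on the thin scheme

Layer `Literature/AlgebraicGeometry/Morphisms` (cell `hodgecm-mathlib`, F-11 sub-line `F11SmoothRoadA`, α1 grandchild
`F11LiftWithLineBundle`, stub G2's cover letter of RULINGS (R30)(b)/(R37); THEOREMS ONLY — no definition, no instance, no notation,
no named fact).  Sequel of ★ `Morphisms/NilpotentThickeningCoverLift` (`exists_principal_affine_cover_lift`: a principal affine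
cover `U₀ j`, `U₀ j ∩ U₀ l = D(b_{jl})`, of the thin scheme `X₀` is the preimage of a principal affine cover of a nilpotent thickening
`i : X₀ ⟶ X`) and of ★ `Morphisms/AffineOfNilpotentThickening` §5 (the base-change form along `Spec (R ↠ R₀)`).

* **`exists_principal_affine_cover_lift_with_frames`** — if moreover the `U₀ j` are SUBORDINATE to opens `W a` of `X₀` carrying
  frames `𝒪^κ ≅ M|_{W a}` of an `𝒪_{X₀}`-module `M`, the lifted principal affine cover `U j` of `X` carries frames
  `𝒪^κ ≅ M|_{i⁻¹ U j}` (restriction of frames, ★ `SheafOfModules.restrictTrivialisation`); `iSup_eq_top_of_preimage_eq` — the lift of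
  a cover covers (opens of `X` are determined by their preimages).
* `exists_principal_affine_cover_lift_with_frames_of_isPullback` — the same for the base change `iQ : Q ×_R R₀ ⟶ Q` of a surjection
  `ρ : R ↠ R₀` with nilpotent kernel (`iQ` is a closed immersion with nilpotent kernel ideal: ★
  `isNilpotent_ker_of_isPullback_specMap`).

Consumer (G2 integrator `MONO-G2`): `ρ = (A → A⧸J)`, `Q = X₁.X` an abelian lift, `Q₀ = A₀.X`, `M = L₀ := Gr₀^* 𝒫₀` (rank one); the
principal affine cover of `A₀.X` subordinate to `L₀`'s trivialising opens comes from the producers `PrincipalAffineCoverOfProj` /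
`PrincipalAffineCoverRefinement` (F0P1b-p05 (g0), RULING (R37)); the frames on `G₁⁻¹ U j` feed
`Deformation/SmoothSchemeLiftObstructionCriterionGlueLineBundleConverse.exists_twistedCocycle_of_frames`.
HC_CM is proved only modulo the 7 printed citations until rung 0 closes — nothing here bears on a summit statement.

## References
* [Hartshorne2010] R. Hartshorne, *Deformation Theory*, GTM 257 (2010): Thm. 10.2 (a) proof (p. 81) (charts of the lift along the closed fibre).
* [StacksProject] The Stacks Project, Tag 06AD (thickenings: same underlying topological space), Tag 01QF.
* [Hartshorne1977] R. Hartshorne, *Algebraic Geometry*, GTM 52 (1977): II §5 (p. 109) (local frames of a locally free sheaf).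
-/

noncomputable section

universe u

open CategoryTheory CategoryTheory.Limits AlgebraicGeometry TopologicalSpace

namespace Literature.AlgebraicGeometry.Morphisms

open Literature.AlgebraicGeometry.Motives

variable {X₀ X : Scheme.{u}} (i : X₀ ⟶ X) [IsClosedImmersion i]

/-! ## §1 Along a closed immersion with nilpotent kernel ideal -/

/-- **Lifted principal affine covers carry the frames of the thin scheme**: for a closed immersion `i : X₀ ⟶ X` with nilpotent
kernel ideal, a principal affine cover `U₀ j` (`U₀ j ∩ U₀ l = D(b_{jl})`) of `X₀` subordinate to opens `W a` with frames
`𝒪^κ ≅ M|_{W a}`, there is a principal affine cover `U j` of `X` with `i⁻¹ U j = U₀ j`, `U j ∩ U l = D(b'_{jl})`, and frames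
`𝒪^κ ≅ M|_{i⁻¹ U j}`. [cite: Hartshorne2010, Thm. 10.2 (proof), p. 81] [cite: StacksProject, Tag 06AD]
[cite: Hartshorne1977, II §5 (p. 109)] -/
theorem exists_principal_affine_cover_lift_with_frames (hnil : IsNilpotent i.ker) {M : X₀.Modules} {κ : Type u}
    {ι : Type*} (U₀ : ι → X₀.affineOpens) (b : (j l : ι) → Γ(X₀, (U₀ j).1))
    (hb : ∀ j l, (U₀ j).1 ⊓ (U₀ l).1 = X₀.basicOpen (b j l))
    {α : Type*} (W : α → X₀.Opens) (t : ∀ a, SheafOfModules.free κ ≅ M.over (W a)) (hsub : ∀ j, ∃ a, (U₀ j).1 ≤ W a) :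
    ∃ (U : ι → X.affineOpens) (b' : (j l : ι) → Γ(X, (U j).1)),
      (∀ j, i ⁻¹ᵁ (U j).1 = (U₀ j).1) ∧ (∀ j l, (U j).1 ⊓ (U l).1 = X.basicOpen (b' j l)) ∧
      ∀ j, Nonempty (SheafOfModules.free κ ≅ M.over (i ⁻¹ᵁ (U j).1)) := by
  obtain ⟨U, b', hU, hb'⟩ := exists_principal_affine_cover_lift i hnil U₀ b hb
  refine ⟨U, b', hU, hb', fun j => ?_⟩
  obtain ⟨a, ha⟩ := hsub j
  exact ⟨SheafOfModules.restrictTrivialisation (R := X₀.ringCatSheaf) (homOfLE ((hU j).le.trans ha)) (t a)⟩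

/-- **The lift of a cover covers**: if `i⁻¹ U j = U₀ j` for all `j` and the `U₀ j` cover `X₀`, the `U j` cover `X` (opens of a
nilpotent thickening are determined by their preimages). [cite: StacksProject, Tag 06AD] -/
theorem iSup_eq_top_of_preimage_eq (hnil : IsNilpotent i.ker) {ι : Type*} (U : ι → X.Opens) (U₀ : ι → X₀.Opens)
    (hU : ∀ j, i ⁻¹ᵁ U j = U₀ j) (hcov : ⨆ j, U₀ j = ⊤) : ⨆ j, U j = ⊤ := by
  refine preimage_injective_of_isNilpotent_ker i hnil ?_
  rw [Scheme.Hom.preimage_iSup, Scheme.Hom.preimage_top]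
  simp_rw [hU]
  exact hcov

/-! ## §2 Base-change form along `Spec (R ↠ R₀)` with nilpotent kernel -/

/-- **Lifted principal affine covers with frames, base-change form**: for a surjection `ρ : R ↠ R₀` with nilpotent kernel and a
cartesian square `iQ : Q₀ = Q ×_R R₀ ⟶ Q`, a principal affine cover of `Q₀` subordinate to opens carrying frames `𝒪^κ ≅ M|_{W a}` of
an `𝒪_{Q₀}`-module `M` lifts to a principal affine cover `U j` of `Q` COVERING `Q`, with `iQ⁻¹ U j = U₀ j` and frames
`𝒪^κ ≅ M|_{iQ⁻¹ U j}` (`iQ` is a closed immersion with nilpotent kernel ideal, ★ `isNilpotent_ker_of_isPullback_specMap`).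
[cite: StacksProject, Tag 06AD] [cite: Hartshorne2010, Thm. 10.2 (proof), p. 81] [cite: Hartshorne1977, II §5 (p. 109)] -/
theorem exists_principal_affine_cover_lift_with_frames_of_isPullback {R R₀ : Type u} [CommRing R] [CommRing R₀]
    (ρ : R →+* R₀) (hρ : Function.Surjective ρ) (hnilρ : IsNilpotent (RingHom.ker ρ)) {Q Q₀ : Scheme.{u}}
    {q : Q ⟶ Spec (.of R)} {q₀ : Q₀ ⟶ Spec (.of R₀)} {iQ : Q₀ ⟶ Q}
    (hQ : IsPullback iQ q₀ q (Spec.map (CommRingCat.ofHom ρ))) {M : Q₀.Modules} {κ : Type u}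
    {ι : Type*} (U₀ : ι → Q₀.affineOpens) (b : (j l : ι) → Γ(Q₀, (U₀ j).1))
    (hb : ∀ j l, (U₀ j).1 ⊓ (U₀ l).1 = Q₀.basicOpen (b j l)) (hcov : ⨆ j, (U₀ j).1 = ⊤)
    {α : Type*} (W : α → Q₀.Opens) (t : ∀ a, SheafOfModules.free κ ≅ M.over (W a)) (hsub : ∀ j, ∃ a, (U₀ j).1 ≤ W a) :
    ∃ (U : ι → Q.affineOpens) (b' : (j l : ι) → Γ(Q, (U j).1)),
      (∀ j, iQ ⁻¹ᵁ (U j).1 = (U₀ j).1) ∧ (∀ j l, (U j).1 ⊓ (U l).1 = Q.basicOpen (b' j l)) ∧ (⨆ j, (U j).1 = ⊤) ∧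
      ∀ j, Nonempty (SheafOfModules.free κ ≅ M.over (iQ ⁻¹ᵁ (U j).1)) := by
  haveI : IsClosedImmersion iQ :=
    MorphismProperty.of_isPullback hQ.flip (IsClosedImmersion.spec_of_surjective _ hρ)
  have hnil : IsNilpotent iQ.ker := isNilpotent_ker_of_isPullback_specMap ρ hρ hnilρ hQ
  obtain ⟨U, b', hU, hb', hfr⟩ := exists_principal_affine_cover_lift_with_frames iQ hnil U₀ b hb W t hsub
  exact ⟨U, b', hU, hb', iSup_eq_top_of_preimage_eq iQ hnil (fun j => (U j).1) (fun j => (U₀ j).1) hU hcov, hfr⟩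

end Literature.AlgebraicGeometry.Morphisms

end
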